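import Literature.Probability.Percolation.ZdFiveArmQuasiMultOfSeparation
import Literature.Probability.Percolation.ZdFiveArmSeparatedE
import HarnessLib

/-!
# Quasi-multiplicativity `(Q)` of the five-arm probability on `ℤ²` from separation with EDGE-disjoint right arms

Topic `Literature/Probability/Percolation`; critical bond percolation on `ℤ²`.  This file re-derives
the conditional theorem `zdFiveArm_quasiMult_of_separation` of `ZdFiveArmQuasiMultOfSeparation.lean`
(Nolin 2008, Prop. 12 (ii) and Prop. 16; DMT 2021, Prop. 6.3 at `q = 1`:
`c · P(T̃(m₁,m)) · P(T̃(m,n)) ≤ P(T̃(m₁,n))`, `T̃ = zdFiveArmClusters`) from the WEAKER and honest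
separation hypothesis

  `hsepE : ∀ n N, m₁ ≤ n → 2n ≤ N → cs · P(zdFiveArmClusters n N) ≤ P(zdFiveArmSepE n N)`,

in which the two fenced right arms of the separated event are only asked to be EDGE-disjoint
(`zdFiveArmSepE`, `ZdFiveArmSeparatedE.lean`) — the form in which Kesten's construction (Kesten 1987,
Lemmas 4–6; Nolin 2008, Thm. 11, Lemma 15 [arXiv: Thm. 10, Lemma 14]) delivers two arms of the same
colour, and all that `zdFiveArmClusters` asks of its third arm.  Everything of the parent file is
reused (fine gluing, the `L`-shaped corridors `exists_chain3`, the corridor events `qCorrOpen`,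
`qCorrDual`, pair sets, zones, RSW/FKG bounds, the dual barriers `qBarrier_T/B`, the bounded-ratio
bookkeeping); what changes is the bookkeeping of EDGES along the two glued right arms: an edge common
to both lies on both edge carriers of one of the two separated events.

* `ZdSepOpenArmR.exists_walk_of_outerCorridor_fineE`, `…_innerCorridor_fineE`, `exists_composedArmQE`,
  `qArm_RposE`, `qArm_RnegE` — the glued right arms with edge bookkeeping;
* `qArms_edgeDisjoint` — the two glued right arms share no edge;
* `qGluedE`, `determinedBy_zdFiveArmSepE`, `measurableSet_zdFiveArmSepE`, `real_zdFiveArmSepE_inter`,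
  `real_qGluedE_ge` — the glued event and its probability;
* `mem_zdFiveArmClusters_of_mem_qGluedE`, `real_zdFiveArmSepE_mul_le_real_zdFiveArmClusters` — the
  gluing inequality `c⁹ · P(SepE(m₁,M)) · P(SepE(8M,n)) ≤ P(T̃(m₁,n))`;
* `zdFiveArm_quasiMult_of_separationE` — **`(Q)` from `hsepE`** (and the five-arm lower bound `h5`
  for bounded ratios, as in the parent file).

No named fact is introduced.

## References

* P. Nolin, EJP 13 (2008), §4.3 Prop. 12, Lemma 13; §4.4 Prop. 16; §8.1 [Nolin2008].
* H. Kesten, CMP 109 (1987), Lemmas 4–6 [KestenScalingCMP1987].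
* H. Duminil-Copin, I. Manolescu, V. Tassion, PTRF 181 (2021), §6.2, Prop. 6.3
  [DuminilCopinManolescuTassion2021].

Tree: `ZdFiveArmQuasiMultOfSeparation.lean` (everything), `ZdFiveArmSeparatedE.lean`,
`SqAnnulusDualBarrier.lean` (`not_openConnIn_sqAnnulus_of_dualArmsTB`).
-/

noncomputable section

open Set _root_.MeasureTheory

namespace Literature.Probability.Percolation

open LatticeModels SimpleGraph

/-! ### Fine gluing with edge bookkeeping -/

section FineGlueE

variable {ω : BondConfig (Site 2)} {n N : ℕ} {lo hi lo' hi' : ℤ} {s y : Site 2}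

/-- Outer gluing, right arm, with support in the body, the outer attaching walk and the outer
fence crossing. [cite: Nolin2008, §4.3, proof of Prop. 12] -/
theorem ZdSepOpenArmR.exists_walk_of_outerCorridor_fineE (A : ZdSepOpenArmR ω n N lo hi lo' hi')
    (hhi' : hi' = lo' + (N / 64 : ℕ)) (hE : 1 ≤ N / 8) (T : (zdGraph 2).Walk s y) (hs : s 0 = N + 1)
    (hy : (N : ℤ) + (N / 8 : ℕ) ≤ y 0)
    (hT : ∀ z ∈ T.support, (N : ℤ) + 1 ≤ z 0 ∧ (z 0 ≤ N + (N / 8 : ℕ) → lo' ≤ z 1 ∧ z 1 ≤ lo' + (N / 64 : ℕ))) :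
    ∃ m ∈ T.support, ∃ U : (zdGraph 2).Walk A.x m,
      (∀ z ∈ U.support, z ∈ A.W.support ∨ z ∈ A.P.support ∨ z ∈ A.V.support) ∧
      (∀ e ∈ U.edges, e ∈ A.edgeCarrier) ∧ ∀ e ∈ U.edges, e ∈ ω := by
  subst hhi'
  obtain ⟨q, T₁, hq, hT₁s, -⟩ := exists_prefix_reach_ge 0 T ((N : ℤ) + (N / 8 : ℕ)) (by rw [hs]; omega) hy
  have hbox : ∀ z ∈ T₁.support, (N : ℤ) + 1 ≤ z 0 ∧ z 0 ≤ N + (N / 8 : ℕ) ∧ lo' ≤ z 1 ∧ z 1 ≤ lo' + (N / 64 : ℕ) := by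
    intro z hz
    obtain ⟨h1, h2⟩ := hT₁s z hz
    obtain ⟨h3, h4⟩ := hT z h2
    exact ⟨h3, h1, h4 h1⟩
  have hz := A.hz
  obtain ⟨m, hmT, hmV⟩ := exists_mem_support_of_vFence (L := (N : ℤ) + 1) (R := (N : ℤ) + (N / 8 : ℕ))
    (B₀ := lo') (B₁ := lo' + (N / 64 : ℕ)) A.V (fun z hz => ⟨(A.hV z hz).1, (A.hV z hz).2.1⟩)
    (by rw [A.hab.1]; omega) (by rw [A.hab.2]; omega) (by omega) T₁ hs hq hbox
  obtain ⟨Uv, hUvs, hUve⟩ := exists_walk_within_support A.V A.hu hmV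
  refine ⟨m, (hT₁s m hmT).2, A.W.append (A.P.append Uv), fun z hz => ?_, fun e he => ?_, fun e he => ?_⟩
  · rw [Walk.mem_support_append_iff, Walk.mem_support_append_iff] at hz
    rcases hz with hz | hz | hz
    · exact Or.inl hz
    · exact Or.inr (Or.inl hz)
    · exact Or.inr (Or.inr (hUvs z hz))
  · rw [Walk.edges_append, List.mem_append, Walk.edges_append, List.mem_append] at he
    rcases he with he | he | he
    · exact Or.inl he
    · exact Or.inr (Or.inr (Or.inl he))
    · exact Or.inr (Or.inl (hUve e he))
  · rw [Walk.edges_append, List.mem_append, Walk.edges_append, List.mem_append] at he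
    rcases he with he | he | he
    · exact A.hWo e he
    · exact A.hPo e he
    · exact A.hVo e (hUve e he)

/-- Inner gluing, right arm, with support in the inner attaching walk and the inner fence
crossing. [cite: Nolin2008, §4.3, proof of Prop. 12] -/
theorem ZdSepOpenArmR.exists_walk_of_innerCorridor_fineE (A : ZdSepOpenArmR ω n N lo hi lo' hi')
    (hhi : hi = lo + (n / 64 : ℕ)) (he : 1 ≤ n / 8) (T : (zdGraph 2).Walk s y) (hy : y 0 + 1 = n)
    (hs : s 0 ≤ (n : ℤ) - (n / 8 : ℕ))
    (hT : ∀ z ∈ T.support, z 0 + 1 ≤ n ∧ ((n : ℤ) - (n / 8 : ℕ) ≤ z 0 → lo ≤ z 1 ∧ z 1 ≤ lo + (n / 64 : ℕ))) :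
    ∃ m ∈ T.support, ∃ U : (zdGraph 2).Walk A.x m,
      (∀ z ∈ U.support, z ∈ A.P'.support ∨ z ∈ A.V'.support) ∧
      (∀ e ∈ U.edges, e ∈ A.edgeCarrier) ∧ ∀ e ∈ U.edges, e ∈ ω := by
  subst hhi
  obtain ⟨q, T₁, hq, hT₁s, -⟩ :=
    exists_prefix_reach_le 0 T.reverse ((n : ℤ) - (n / 8 : ℕ)) (by omega) hs
  have hbox : ∀ z ∈ T₁.reverse.support, (n : ℤ) - (n / 8 : ℕ) ≤ z 0 ∧ z 0 ≤ (n : ℤ) - 1 ∧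
      lo ≤ z 1 ∧ z 1 ≤ lo + (n / 64 : ℕ) := by
    intro z hz
    rw [Walk.support_reverse, List.mem_reverse] at hz
    obtain ⟨h1, h2⟩ := hT₁s z hz
    rw [Walk.support_reverse, List.mem_reverse] at h2
    obtain ⟨h3, h4⟩ := hT z h2
    exact ⟨h1, by omega, h4 h1⟩
  have hx := A.hx
  obtain ⟨m, hmT, hmV⟩ := exists_mem_support_of_vFence (L := (n : ℤ) - (n / 8 : ℕ)) (R := (n : ℤ) - 1)
    (B₀ := lo) (B₁ := lo + (n / 64 : ℕ)) A.V' (fun z hz => ⟨(A.hV' z hz).1, by have := (A.hV' z hz).2.1; omega⟩)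
    (by rw [A.hab'.1]; omega) (by rw [A.hab'.2]; omega) (by omega) T₁.reverse hq (by omega) hbox
  obtain ⟨Uv, hUvs, hUve⟩ := exists_walk_within_support A.V' A.hu' hmV
  have hmT' : m ∈ T.support := by
    rw [Walk.support_reverse, List.mem_reverse] at hmT
    have := (hT₁s m hmT).2
    rwa [Walk.support_reverse, List.mem_reverse] at this
  refine ⟨m, hmT', A.P'.append Uv, fun z hz => ?_, fun e he => ?_, fun e he => ?_⟩
  · rw [Walk.mem_support_append_iff] at hz
    rcases hz with hz | hz
    · exact Or.inl hz
    · exact Or.inr (hUvs z hz)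
  · rw [Walk.edges_append, List.mem_append] at he
    rcases he with he | he
    · exact Or.inr (Or.inr (Or.inr (Or.inr he)))
    · exact Or.inr (Or.inr (Or.inr (Or.inl (hUve e he))))
  · rw [Walk.edges_append, List.mem_append] at he
    rcases he with he | he
    · exact A.hP'o e he
    · exact A.hV'o e (hUve e he)

end FineGlueE

/-! ### The glued right arms of `(Q)` with edge bookkeeping -/

section QOpenArmsE

/-- **Composition of a glued arm of `(Q)`**: outer gluing walk of the inner event, corridor
segment between the two meeting points, inner gluing walk of the outer event (reversed), body of
the outer event. [folklore] -/
theorem exists_composedArmQE {ω : BondConfig (Site 2)} {x mo mi s y x' z' : Site 2}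
    (Uo : (zdGraph 2).Walk x mo) (T : (zdGraph 2).Walk s y) (hmo : mo ∈ T.support) (hmi : mi ∈ T.support)
    (Ui : (zdGraph 2).Walk x' mi) (W : (zdGraph 2).Walk x' z')
    (h1 : ∀ e ∈ Uo.edges, e ∈ ω) (h2 : ∀ e ∈ T.edges, e ∈ ω) (h3 : ∀ e ∈ Ui.edges, e ∈ ω) (h4 : ∀ e ∈ W.edges, e ∈ ω) :
    ∃ P : (zdGraph 2).Walk x z', (∀ e ∈ P.edges, e ∈ ω) ∧
      (∀ z ∈ P.support, z ∈ Uo.support ∨ z ∈ T.support ∨ z ∈ Ui.support ∨ z ∈ W.support) ∧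
      ∀ e ∈ P.edges, e ∈ Uo.edges ∨ e ∈ T.edges ∨ e ∈ Ui.edges ∨ e ∈ W.edges := by
  obtain ⟨Ts, hTss, hTse⟩ := exists_walk_within_support T hmo hmi
  refine ⟨Uo.append (Ts.append (Ui.reverse.append W)), fun e he => ?_, fun z hz => ?_, fun e he => ?_⟩
  · simp only [Walk.edges_append, List.mem_append, Walk.edges_reverse, List.mem_reverse] at he
    rcases he with he | he | he | he
    · exact h1 e he
    · exact h2 e (hTse e he)
    · exact h3 e he
    · exact h4 e he
  · simp only [Walk.mem_support_append_iff, Walk.support_reverse, List.mem_reverse] at hz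
    rcases hz with hz | hz | hz | hz
    · exact Or.inl hz
    · exact Or.inr (Or.inl (hTss z hz))
    · exact Or.inr (Or.inr (Or.inl hz))
    · exact Or.inr (Or.inr (Or.inr hz))
  · simp only [Walk.edges_append, List.mem_append, Walk.edges_reverse, List.mem_reverse] at he
    rcases he with he | he | he | he
    · exact Or.inl he
    · exact Or.inr (Or.inl (hTse e he))
    · exact Or.inr (Or.inr (Or.inl he))
    · exact Or.inr (Or.inr (Or.inr he))

variable {m₁ M n : ℕ}

set_option maxHeartbeats 1600000 in
/-- **The glued upper right arm of `(Q)`, with edges.** [cite: Nolin2008, §4.3, Prop. 12 (ii)] -/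
theorem qArm_RposE (hm₁ : 128 ≤ m₁) (hM : 2 * m₁ ≤ M) (hn : 16 * M ≤ n) {ω : BondConfig (Site 2)}
    (hωE : ω ⊆ (zdGraph 2).edgeSet)
    (A₁ : ZdSepOpenArmR ω m₁ M (m₁ / 4 : ℕ) ((m₁ / 4 : ℕ) + (m₁ / 64 : ℕ)) (M / 4 : ℕ) ((M / 4 : ℕ) + (M / 64 : ℕ)))
    (A₂ : ZdSepOpenArmR ω (8 * M) n ((8 * M) / 4 : ℕ) (((8 * M) / 4 : ℕ) + ((8 * M) / 64 : ℕ)) (n / 4 : ℕ) ((n / 4 : ℕ) + (n / 64 : ℕ)))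
    (hR1 : ω ∈ lrCrossingAt ![(M : ℤ) + 1, (M / 4 : ℕ)] (3 * M + M / 8 - 1) (M / 64))
    (hR2 : ω ∈ tbCrossingAt' ![4 * (M : ℤ), (M / 4 : ℕ)] (M / 8) (2 * M + M / 8 - M / 4))
    (hR3 : ω ∈ lrCrossingAt ![4 * (M : ℤ), 2 * (M : ℤ)] (4 * M - 1) (M / 8)) :
    ∃ W : (zdGraph 2).Walk A₁.x A₂.z, (∀ e ∈ W.edges, e ∈ ω) ∧ (∀ z ∈ W.support, z ∈ sqAnnulus m₁ n) ∧
      (∀ z ∈ W.support, z ∈ A₁.carrier ∨ (0 < z 1 ∧ (M : ℤ) + 1 ≤ z 0 ∧ z 0 + 1 ≤ 8 * M ∧ z 1 ≤ 3 * M) ∨ z ∈ A₂.carrier) ∧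
      ∀ e ∈ W.edges, e ∈ A₁.edgeCarrier ∨
        (∀ z ∈ e, 0 < z 1 ∧ (M : ℤ) + 1 ≤ z 0 ∧ z 0 + 1 ≤ 8 * M ∧ z 1 ≤ 3 * M) ∨ e ∈ A₂.edgeCarrier := by
  have hm1 : 1 ≤ m₁ := by omega
  have hE : 1 ≤ M / 8 := by omega
  have he8 : 1 ≤ (8 * M) / 8 := by omega
  have e4 : (((8 * M) / 4 : ℕ) : ℤ) = 2 * M := by omega
  have e8 : (((8 * M) / 8 : ℕ) : ℤ) = M := by omega
  have e64 : (((8 * M) / 64 : ℕ) : ℤ) = (M / 8 : ℕ) := by omega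
  obtain ⟨s₁, y₁, T₁, hs₁, hy₁, hT₁s, hT₁e⟩ := exists_walk_of_mem_lrCrossingAt hωE hR1
  obtain ⟨s₂, y₂, T₂, hs₂, hy₂, hT₂s, hT₂e⟩ := exists_walk_of_mem_tbCrossingAt hωE hR2
  obtain ⟨s₃, y₃, T₃, hs₃, hy₃, hT₃s, hT₃e⟩ := exists_walk_of_mem_lrCrossingAt hωE hR3
  simp only [Matrix.cons_val_zero, Matrix.cons_val_one] at hs₁ hy₁ hT₁s hs₂ hy₂ hT₂s hs₃ hy₃ hT₃s
  have c1 : ((3 * M + M / 8 - 1 : ℕ) : ℤ) = 3 * M + (M / 8 : ℕ) - 1 := by omega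
  have c2 : ((2 * M + M / 8 - M / 4 : ℕ) : ℤ) = 2 * M + (M / 8 : ℕ) - (M / 4 : ℕ) := by omega
  have c3 : ((4 * M - 1 : ℕ) : ℤ) = 4 * M - 1 := by omega
  rw [c1] at hy₁ hT₁s; rw [c2] at hy₂ hT₂s; rw [c3] at hy₃ hT₃s
  obtain ⟨T, hTe, hTs⟩ := exists_chain3 (a := (M : ℤ) + 1) (X₁ := 4 * (M : ℤ)) (X₂ := 4 * (M : ℤ) + (M / 8 : ℕ))
    (b := 8 * (M : ℤ) - 1) (Y₀ := ((M / 4 : ℕ) : ℤ)) (Y₁ := 2 * (M : ℤ) + (M / 8 : ℕ)) (I₁lo := ((M / 4 : ℕ) : ℤ))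
    (I₁hi := ((M / 4 : ℕ) : ℤ) + (M / 64 : ℕ)) (I₃lo := 2 * (M : ℤ)) (I₃hi := 2 * (M : ℤ) + (M / 8 : ℕ))
    (by omega) (by omega) (by omega) ⟨by omega, by omega, by omega⟩ ⟨by omega, by omega, by omega⟩
    T₁ hs₁ (by rw [hy₁]; ring) (fun z hz => by have := hT₁s z hz; exact ⟨this.1, by omega, this.2.2.1, this.2.2.2⟩) hT₁e
    T₂ hs₂ (by rw [hy₂]; omega) (fun z hz => by have := hT₂s z hz; exact ⟨this.1, by omega, this.2.2.1, by omega⟩) hT₂e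
    T₃ hs₃ (by rw [hy₃]; ring) (fun z hz => by have := hT₃s z hz; exact ⟨this.1, by omega, this.2.2.1, this.2.2.2⟩) hT₃e
  have hTbox : ∀ z ∈ T.support, (M : ℤ) + 1 ≤ z 0 ∧ z 0 + 1 ≤ 8 * M ∧ 0 < z 1 ∧ z 1 ≤ 3 * M := by
    intro z hz
    rcases hTs z hz with h | h | h
    · have := hT₁s z h; exact ⟨this.1, by omega, by omega, by omega⟩
    · have := hT₂s z h; exact ⟨by omega, by omega, by omega, by omega⟩
    · have := hT₃s z h; exact ⟨by omega, by omega, by omega, by omega⟩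
  have hTo : ∀ z ∈ T.support, (M : ℤ) + 1 ≤ z 0 ∧ (z 0 ≤ (M : ℤ) + (M / 8 : ℕ) → ((M / 4 : ℕ) : ℤ) ≤ z 1 ∧ z 1 ≤ ((M / 4 : ℕ) : ℤ) + (M / 64 : ℕ)) := by
    intro z hz
    rcases hTs z hz with h | h | h
    · have := hT₁s z h; exact ⟨this.1, fun _ => ⟨this.2.2.1, this.2.2.2⟩⟩
    · have := hT₂s z h; exact ⟨by omega, fun h' => by omega⟩
    · have := hT₃s z h; exact ⟨by omega, fun h' => by omega⟩
  have hTi : ∀ z ∈ T.support, z 0 + 1 ≤ ((8 * M : ℕ) : ℤ) ∧ (((8 * M : ℕ) : ℤ) - ((8 * M) / 8 : ℕ) ≤ z 0 →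
      (((8 * M) / 4 : ℕ) : ℤ) ≤ z 1 ∧ z 1 ≤ (((8 * M) / 4 : ℕ) : ℤ) + ((8 * M) / 64 : ℕ)) := by
    intro z hz
    rw [e4, e8, e64]; push_cast
    rcases hTs z hz with h | h | h
    · have := hT₁s z h; exact ⟨by omega, fun h' => by omega⟩
    · have := hT₂s z h; exact ⟨by omega, fun h' => by omega⟩
    · have := hT₃s z h; exact ⟨by omega, fun _ => ⟨this.2.2.1, this.2.2.2⟩⟩
  obtain ⟨mo, hmo, Uo, hUos, hUoE, hUoe⟩ := A₁.exists_walk_of_outerCorridor_fineE rfl hE T hs₁ (by rw [hy₃]; omega) hTo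
  obtain ⟨mi, hmi, Ui, hUis, hUiE, hUie⟩ := A₂.exists_walk_of_innerCorridor_fineE rfl he8 T (by rw [hy₃]; push_cast; ring)
    (by rw [hs₁, e8]; push_cast; omega) hTi
  obtain ⟨W, hWe, hWs, hWE⟩ := exists_composedArmQE Uo T hmo hmi Ui A₂.W hUoe hTe hUie A₂.hWo
  refine ⟨W, hWe, fun z hz => ?_, fun z hz => ?_, fun e he => ?_⟩
  · rcases hWs z hz with h | h | h | h
    · exact (A₁.outer_pieces_mem hm1 hM hn (abs_le.2 ⟨by omega, by omega⟩) (abs_le.2 ⟨by omega, by omega⟩) (hUos z h)).1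
    · have := hTbox z h
      rw [mem_sqAnnulus_iff hm1, Fin.forall_fin_two, Fin.exists_fin_two]
      exact ⟨⟨⟨by omega, by omega⟩, ⟨by omega, by omega⟩⟩, Or.inl (Or.inl (by omega))⟩
    · refine (A₂.inner_pieces_mem hm1 hM hn (abs_le.2 ⟨by omega, by omega⟩) (abs_le.2 ⟨by omega, by omega⟩) ?_).1
      rcases hUis z h with h | h
      · exact Or.inl h
      · exact Or.inr (Or.inl h)
    · exact (A₂.inner_pieces_mem hm1 hM hn (abs_le.2 ⟨by omega, by omega⟩) (abs_le.2 ⟨by omega, by omega⟩)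
        (Or.inr (Or.inr h))).1
  · rcases hWs z hz with h | h | h | h
    · left; rcases hUos z h with h | h | h
      · exact Or.inl h
      · exact Or.inr (Or.inr (Or.inl h))
      · exact Or.inr (Or.inl h)
    · right; left; have := hTbox z h; exact ⟨this.2.2.1, this.1, this.2.1, this.2.2.2⟩
    · right; right; rcases hUis z h with h | h
      · exact Or.inr (Or.inr (Or.inr (Or.inr h)))
      · exact Or.inr (Or.inr (Or.inr (Or.inl h)))
    · right; right; exact Or.inl h
  · rcases hWE e he with h | h | h | h
    · exact Or.inl (hUoE e h)
    · right; left
      intro z hz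
      have := hTbox z (forall_mem_support_of_mem_edges T h z hz)
      exact ⟨this.2.2.1, this.1, this.2.1, this.2.2.2⟩
    · exact Or.inr (Or.inr (hUiE e h))
    · exact Or.inr (Or.inr (Or.inl h))

set_option maxHeartbeats 1600000 in
/-- **The glued lower right arm of `(Q)`, with edges.** [cite: Nolin2008, §4.3, Prop. 12 (ii)] -/
theorem qArm_RnegE (hm₁ : 128 ≤ m₁) (hM : 2 * m₁ ≤ M) (hn : 16 * M ≤ n) {ω : BondConfig (Site 2)}
    (hωE : ω ⊆ (zdGraph 2).edgeSet)
    (A₁ : ZdSepOpenArmR ω m₁ M (-((m₁ / 4 : ℕ) + (m₁ / 64 : ℕ) : ℤ)) (-(m₁ / 4 : ℕ)) (-((M / 4 : ℕ) + (M / 64 : ℕ) : ℤ)) (-(M / 4 : ℕ)))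
    (A₂ : ZdSepOpenArmR ω (8 * M) n (-(((8 * M) / 4 : ℕ) + ((8 * M) / 64 : ℕ) : ℤ)) (-((8 * M) / 4 : ℕ))
      (-((n / 4 : ℕ) + (n / 64 : ℕ) : ℤ)) (-(n / 4 : ℕ)))
    (hS1 : ω ∈ lrCrossingAt ![(M : ℤ) + 1, -((M / 4 : ℕ) + (M / 64 : ℕ) : ℤ)] (3 * M + M / 8 - 1) (M / 64))
    (hS2 : ω ∈ tbCrossingAt' ![4 * (M : ℤ), -(2 * (M : ℤ) + (M / 8 : ℕ))] (M / 8) (2 * M + M / 8 - M / 4))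
    (hS3 : ω ∈ lrCrossingAt ![4 * (M : ℤ), -(2 * (M : ℤ) + (M / 8 : ℕ))] (4 * M - 1) (M / 8)) :
    ∃ W : (zdGraph 2).Walk A₁.x A₂.z, (∀ e ∈ W.edges, e ∈ ω) ∧ (∀ z ∈ W.support, z ∈ sqAnnulus m₁ n) ∧
      (∀ z ∈ W.support, z ∈ A₁.carrier ∨ (z 1 < 0 ∧ (M : ℤ) + 1 ≤ z 0 ∧ z 0 + 1 ≤ 8 * M ∧ -(3 * (M : ℤ)) ≤ z 1) ∨ z ∈ A₂.carrier) ∧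
      ∀ e ∈ W.edges, e ∈ A₁.edgeCarrier ∨
        (∀ z ∈ e, z 1 < 0 ∧ (M : ℤ) + 1 ≤ z 0 ∧ z 0 + 1 ≤ 8 * M ∧ -(3 * (M : ℤ)) ≤ z 1) ∨ e ∈ A₂.edgeCarrier := by
  have hm1 : 1 ≤ m₁ := by omega
  have hE : 1 ≤ M / 8 := by omega
  have he8 : 1 ≤ (8 * M) / 8 := by omega
  have e4 : (((8 * M) / 4 : ℕ) : ℤ) = 2 * M := by omega
  have e8 : (((8 * M) / 8 : ℕ) : ℤ) = M := by omega
  have e64 : (((8 * M) / 64 : ℕ) : ℤ) = (M / 8 : ℕ) := by omega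
  obtain ⟨s₁, y₁, T₁, hs₁, hy₁, hT₁s, hT₁e⟩ := exists_walk_of_mem_lrCrossingAt hωE hS1
  obtain ⟨s₂, y₂, T₂, hs₂, hy₂, hT₂s, hT₂e⟩ := exists_walk_of_mem_tbCrossingAt hωE hS2
  obtain ⟨s₃, y₃, T₃, hs₃, hy₃, hT₃s, hT₃e⟩ := exists_walk_of_mem_lrCrossingAt hωE hS3
  simp only [Matrix.cons_val_zero, Matrix.cons_val_one] at hs₁ hy₁ hT₁s hs₂ hy₂ hT₂s hs₃ hy₃ hT₃s
  have c1 : ((3 * M + M / 8 - 1 : ℕ) : ℤ) = 3 * M + (M / 8 : ℕ) - 1 := by omega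
  have c2 : ((2 * M + M / 8 - M / 4 : ℕ) : ℤ) = 2 * M + (M / 8 : ℕ) - (M / 4 : ℕ) := by omega
  have c3 : ((4 * M - 1 : ℕ) : ℤ) = 4 * M - 1 := by omega
  rw [c1] at hy₁ hT₁s; rw [c2] at hy₂ hT₂s; rw [c3] at hy₃ hT₃s
  obtain ⟨T, hTe, hTs⟩ := exists_chain3 (a := (M : ℤ) + 1) (X₁ := 4 * (M : ℤ)) (X₂ := 4 * (M : ℤ) + (M / 8 : ℕ))
    (b := 8 * (M : ℤ) - 1) (Y₀ := -(2 * (M : ℤ) + (M / 8 : ℕ))) (Y₁ := -((M / 4 : ℕ) : ℤ))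
    (I₁lo := -(((M / 4 : ℕ) : ℤ) + (M / 64 : ℕ))) (I₁hi := -((M / 4 : ℕ) : ℤ))
    (I₃lo := -(2 * (M : ℤ) + (M / 8 : ℕ))) (I₃hi := -(2 * (M : ℤ)))
    (by omega) (by omega) (by omega) ⟨by omega, by omega, by omega⟩ ⟨by omega, by omega, by omega⟩
    T₁ hs₁ (by rw [hy₁]; ring) (fun z hz => by have := hT₁s z hz; exact ⟨this.1, by omega, by omega, by omega⟩) hT₁e
    T₂ hs₂ (by rw [hy₂]; omega) (fun z hz => by have := hT₂s z hz; exact ⟨this.1, by omega, this.2.2.1, by omega⟩) hT₂e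
    T₃ hs₃ (by rw [hy₃]; ring) (fun z hz => by have := hT₃s z hz; exact ⟨this.1, by omega, this.2.2.1, by omega⟩) hT₃e
  have hTbox : ∀ z ∈ T.support, (M : ℤ) + 1 ≤ z 0 ∧ z 0 + 1 ≤ 8 * M ∧ z 1 < 0 ∧ -(3 * (M : ℤ)) ≤ z 1 := by
    intro z hz
    rcases hTs z hz with h | h | h
    · have := hT₁s z h; exact ⟨this.1, by omega, by omega, by omega⟩
    · have := hT₂s z h; exact ⟨by omega, by omega, by omega, by omega⟩
    · have := hT₃s z h; exact ⟨by omega, by omega, by omega, by omega⟩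
  have hTo : ∀ z ∈ T.support, (M : ℤ) + 1 ≤ z 0 ∧ (z 0 ≤ (M : ℤ) + (M / 8 : ℕ) →
      -((M / 4 : ℕ) + (M / 64 : ℕ) : ℤ) ≤ z 1 ∧ z 1 ≤ -((M / 4 : ℕ) + (M / 64 : ℕ) : ℤ) + (M / 64 : ℕ)) := by
    intro z hz
    rcases hTs z hz with h | h | h
    · have := hT₁s z h; exact ⟨this.1, fun _ => ⟨by omega, by omega⟩⟩
    · have := hT₂s z h; exact ⟨by omega, fun h' => by omega⟩
    · have := hT₃s z h; exact ⟨by omega, fun h' => by omega⟩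
  have hTi : ∀ z ∈ T.support, z 0 + 1 ≤ ((8 * M : ℕ) : ℤ) ∧ (((8 * M : ℕ) : ℤ) - ((8 * M) / 8 : ℕ) ≤ z 0 →
      -(((8 * M) / 4 : ℕ) + ((8 * M) / 64 : ℕ) : ℤ) ≤ z 1 ∧ z 1 ≤ -(((8 * M) / 4 : ℕ) + ((8 * M) / 64 : ℕ) : ℤ) + ((8 * M) / 64 : ℕ)) := by
    intro z hz
    rw [e4, e8, e64]; push_cast
    rcases hTs z hz with h | h | h
    · have := hT₁s z h; exact ⟨by omega, fun h' => by omega⟩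
    · have := hT₂s z h; exact ⟨by omega, fun h' => by omega⟩
    · have := hT₃s z h; exact ⟨by omega, fun _ => ⟨by omega, by omega⟩⟩
  obtain ⟨mo, hmo, Uo, hUos, hUoE, hUoe⟩ := A₁.exists_walk_of_outerCorridor_fineE (by push_cast; ring) hE T hs₁ (by rw [hy₃]; omega) hTo
  obtain ⟨mi, hmi, Ui, hUis, hUiE, hUie⟩ := A₂.exists_walk_of_innerCorridor_fineE (by push_cast; ring) he8 T
    (by rw [hy₃]; push_cast; ring) (by rw [hs₁, e8]; push_cast; omega) hTi
  obtain ⟨W, hWe, hWs, hWE⟩ := exists_composedArmQE Uo T hmo hmi Ui A₂.W hUoe hTe hUie A₂.hWo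
  refine ⟨W, hWe, fun z hz => ?_, fun z hz => ?_, fun e he => ?_⟩
  · rcases hWs z hz with h | h | h | h
    · exact (A₁.outer_pieces_mem hm1 hM hn (abs_le.2 ⟨by omega, by omega⟩) (abs_le.2 ⟨by omega, by omega⟩) (hUos z h)).1
    · have := hTbox z h
      rw [mem_sqAnnulus_iff hm1, Fin.forall_fin_two, Fin.exists_fin_two]
      exact ⟨⟨⟨by omega, by omega⟩, ⟨by omega, by omega⟩⟩, Or.inl (Or.inl (by omega))⟩
    · refine (A₂.inner_pieces_mem hm1 hM hn (abs_le.2 ⟨by omega, by omega⟩) (abs_le.2 ⟨by omega, by omega⟩) ?_).1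
      rcases hUis z h with h | h
      · exact Or.inl h
      · exact Or.inr (Or.inl h)
    · exact (A₂.inner_pieces_mem hm1 hM hn (abs_le.2 ⟨by omega, by omega⟩) (abs_le.2 ⟨by omega, by omega⟩)
        (Or.inr (Or.inr h))).1
  · rcases hWs z hz with h | h | h | h
    · left; rcases hUos z h with h | h | h
      · exact Or.inl h
      · exact Or.inr (Or.inr (Or.inl h))
      · exact Or.inr (Or.inl h)
    · right; left; have := hTbox z h; exact ⟨this.2.2.1, this.1, this.2.1, this.2.2.2⟩
    · right; right; rcases hUis z h with h | h
      · exact Or.inr (Or.inr (Or.inr (Or.inr h)))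
      · exact Or.inr (Or.inr (Or.inr (Or.inl h)))
    · right; right; exact Or.inl h
  · rcases hWE e he with h | h | h | h
    · exact Or.inl (hUoE e h)
    · right; left
      intro z hz
      have := hTbox z (forall_mem_support_of_mem_edges T h z hz)
      exact ⟨this.2.2.1, this.1, this.2.1, this.2.2.2⟩
    · exact Or.inr (Or.inr (hUiE e h))
    · exact Or.inr (Or.inr (Or.inl h))

set_option maxHeartbeats 1600000 in
/-- **The two glued right arms of `(Q)` are edge-disjoint**: an edge lying on one of the three kinds
of pieces of each would be, in the only compatible cases, an edge of both edge carriers of the inner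
separated event or of both edge carriers of the outer one. [folklore] -/
theorem qArms_edgeDisjoint (hm₁ : 128 ≤ m₁) (hM : 2 * m₁ ≤ M) (hn : 16 * M ≤ n) {ω : BondConfig (Site 2)}
    (A₁ : ZdSepOpenArmR ω m₁ M (m₁ / 4 : ℕ) ((m₁ / 4 : ℕ) + (m₁ / 64 : ℕ)) (M / 4 : ℕ) ((M / 4 : ℕ) + (M / 64 : ℕ)))
    (B₁ : ZdSepOpenArmR ω m₁ M (-((m₁ / 4 : ℕ) + (m₁ / 64 : ℕ) : ℤ)) (-(m₁ / 4 : ℕ)) (-((M / 4 : ℕ) + (M / 64 : ℕ) : ℤ)) (-(M / 4 : ℕ)))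
    (hd₁ : Disjoint A₁.edgeCarrier B₁.edgeCarrier)
    (A₂ : ZdSepOpenArmR ω (8 * M) n ((8 * M) / 4 : ℕ) (((8 * M) / 4 : ℕ) + ((8 * M) / 64 : ℕ)) (n / 4 : ℕ) ((n / 4 : ℕ) + (n / 64 : ℕ)))
    (B₂ : ZdSepOpenArmR ω (8 * M) n (-(((8 * M) / 4 : ℕ) + ((8 * M) / 64 : ℕ) : ℤ)) (-((8 * M) / 4 : ℕ))
      (-((n / 4 : ℕ) + (n / 64 : ℕ) : ℤ)) (-(n / 4 : ℕ)))
    (hd₂ : Disjoint A₂.edgeCarrier B₂.edgeCarrier) {ε : Sym2 (Site 2)} {z : Site 2} (hzε : z ∈ ε)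
    (h₁ : ε ∈ A₁.edgeCarrier ∨ (∀ z ∈ ε, 0 < z 1 ∧ (M : ℤ) + 1 ≤ z 0 ∧ z 0 + 1 ≤ 8 * M ∧ z 1 ≤ 3 * M) ∨ ε ∈ A₂.edgeCarrier)
    (h₃ : ε ∈ B₁.edgeCarrier ∨ (∀ z ∈ ε, z 1 < 0 ∧ (M : ℤ) + 1 ≤ z 0 ∧ z 0 + 1 ≤ 8 * M ∧ -(3 * (M : ℤ)) ≤ z 1) ∨ ε ∈ B₂.edgeCarrier) :
    False := by
  have hm1 : 1 ≤ m₁ := by omega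
  have e4 : (((8 * M) / 4 : ℕ) : ℤ) = 2 * M := by omega
  have e8 : (((8 * M) / 8 : ℕ) : ℤ) = M := by omega
  have annR : ∀ {k N : ℕ}, 1 ≤ k → ∀ v ∈ sqAnnulus k N, |v 0| ≤ N ∧ |v 1| ≤ N ∧ ((k : ℤ) ≤ |v 0| ∨ (k : ℤ) ≤ |v 1|) := by
    intro k N hk v hv
    rw [mem_sqAnnulus_iff hk, Fin.forall_fin_two, Fin.exists_fin_two] at hv
    obtain ⟨⟨h0, h1⟩, h2⟩ := hv
    refine ⟨abs_le.2 ⟨h0.1, h0.2⟩, abs_le.2 ⟨h1.1, h1.2⟩, ?_⟩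
    rcases h2 with h2 | h2 <;> [left; right] <;> rw [le_abs] <;> omega
  have s1p : ∀ v ∈ A₁.carrier, v ∈ sqAnnulus m₁ M ∨ 0 < v 1 := by
    intro v hv; rcases A₁.carrier_cases (by omega) (by omega) hv with h | h | h
    · exact Or.inl h
    · right; omega
    · right; omega
  have s1m : ∀ v ∈ B₁.carrier, v ∈ sqAnnulus m₁ M ∨ v 1 < 0 := by
    intro v hv; rcases B₁.carrier_cases (by omega) (by omega) hv with h | h | h
    · exact Or.inl h
    · right; omega
    · right; omega
  have s2p : ∀ v ∈ A₂.carrier, v ∈ sqAnnulus (8 * M) n ∨ 0 < v 1 := by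
    intro v hv; rcases A₂.carrier_cases (by omega) (by omega) hv with h | h | h
    · exact Or.inl h
    · right; omega
    · right; rw [e4, e8] at h; omega
  have s2m : ∀ v ∈ B₂.carrier, v ∈ sqAnnulus (8 * M) n ∨ v 1 < 0 := by
    intro v hv; rcases B₂.carrier_cases (by omega) (by omega) hv with h | h | h
    · exact Or.inl h
    · right; omega
    · right; rw [e4, e8] at h; omega
  have zone1 : ∀ {lo hi lo' hi' : ℤ} (C : ZdSepOpenArmR ω m₁ M lo hi lo' hi'),
      |lo| ≤ ((m₁ / 4 : ℕ) : ℤ) + (m₁ / 64 : ℕ) → |hi| ≤ ((m₁ / 4 : ℕ) : ℤ) + (m₁ / 64 : ℕ) →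
      |lo'| ≤ ((M / 4 : ℕ) : ℤ) + (M / 64 : ℕ) → |hi'| ≤ ((M / 4 : ℕ) : ℤ) + (M / 64 : ℕ) →
      ∀ v ∈ C.carrier, |v 0| ≤ (M : ℤ) + (M / 8 : ℕ) + 1 ∧ |v 1| ≤ (M : ℤ) + (M / 8 : ℕ) + 1 := by
    intro lo hi lo' hi' C h1 h2 h3 h4 v hv
    have hz : v ∈ zdSepZoneR m₁ M := by
      rcases C.carrier_subset h1 h2 h3 h4 hv with h | h | h
      · exact Or.inl h
      · exact Or.inr (Or.inl h)
      · exact Or.inr (Or.inr h)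
    exact (zone_sites hm₁ hM (Or.inl (Or.inl hz))).1
  have zone2 : ∀ {lo hi lo' hi' : ℤ} (C : ZdSepOpenArmR ω (8 * M) n lo hi lo' hi'),
      |lo| ≤ (((8 * M) / 4 : ℕ) : ℤ) + ((8 * M) / 64 : ℕ) → |hi| ≤ (((8 * M) / 4 : ℕ) : ℤ) + ((8 * M) / 64 : ℕ) →
      |lo'| ≤ ((n / 4 : ℕ) : ℤ) + (n / 64 : ℕ) → |hi'| ≤ ((n / 4 : ℕ) : ℤ) + (n / 64 : ℕ) →
      ∀ v ∈ C.carrier, 4 * (M : ℤ) + 1 ≤ |v 0| ∨ 4 * (M : ℤ) + 1 ≤ |v 1| := by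
    intro lo hi lo' hi' C h1 h2 h3 h4 v hv
    have hz : v ∈ zdSepZoneR (8 * M) n := by
      rcases C.carrier_subset h1 h2 h3 h4 hv with h | h | h
      · exact Or.inl h
      · exact Or.inr (Or.inl h)
      · exact Or.inr (Or.inr h)
    have := (zone_sites (k := 8 * M) (N := n) (by omega) (by omega) (Or.inl (Or.inl hz))).2.1
    push_cast at this
    omega
  have hq : 0 ≤ ((m₁ / 4 : ℕ) : ℤ) + (m₁ / 64 : ℕ) := by positivity
  have hQ : 0 ≤ ((M / 4 : ℕ) : ℤ) + (M / 64 : ℕ) := by positivity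
  have hq8 : 0 ≤ (((8 * M) / 4 : ℕ) : ℤ) + ((8 * M) / 64 : ℕ) := by positivity
  have hQn : 0 ≤ ((n / 4 : ℕ) : ℤ) + (n / 64 : ℕ) := by positivity
  have b1A := zone1 A₁ (abs_le.2 ⟨by omega, by omega⟩) (abs_le.2 ⟨by omega, le_rfl⟩) (abs_le.2 ⟨by omega, by omega⟩) (abs_le.2 ⟨by omega, le_rfl⟩)
  have b1B := zone1 B₁ (abs_le.2 ⟨by omega, by omega⟩) (abs_le.2 ⟨by omega, by omega⟩) (abs_le.2 ⟨by omega, by omega⟩) (abs_le.2 ⟨by omega, by omega⟩)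
  have b2A := zone2 A₂ (abs_le.2 ⟨by omega, by omega⟩) (abs_le.2 ⟨by omega, le_rfl⟩) (abs_le.2 ⟨by omega, by omega⟩) (abs_le.2 ⟨by omega, le_rfl⟩)
  have b2B := zone2 B₂ (abs_le.2 ⟨by omega, by omega⟩) (abs_le.2 ⟨by omega, by omega⟩) (abs_le.2 ⟨by omega, by omega⟩) (abs_le.2 ⟨by omega, by omega⟩)
  rcases h₁ with h1 | h1 | h1 <;> rcases h₃ with h3 | h3 | h3
  · exact Set.disjoint_left.1 hd₁ h1 h3
  · have h1 := A₁.mem_carrier_of_mem_edgeCarrier h1 hzε; have h3 := h3 z hzε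
    rcases s1p z h1 with h | h
    · have := (annR hm1 z h).1; rw [abs_le] at this; omega
    · omega
  · have h1 := A₁.mem_carrier_of_mem_edgeCarrier h1 hzε; have h3 := B₂.mem_carrier_of_mem_edgeCarrier h3 hzε
    have a := b1A z h1; have b := b2B z h3
    rw [abs_le, abs_le] at a; rw [le_abs, le_abs] at b; omega
  · have h1 := h1 z hzε; have h3 := B₁.mem_carrier_of_mem_edgeCarrier h3 hzε
    rcases s1m z h3 with h | h
    · have := (annR hm1 z h).1; rw [abs_le] at this; omega
    · omega
  · have h1 := h1 z hzε; have h3 := h3 z hzε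
    omega
  · have h1 := h1 z hzε; have h3 := B₂.mem_carrier_of_mem_edgeCarrier h3 hzε
    rcases s2m z h3 with h | h
    · have := (annR (k := 8 * M) (by omega) z h).2.2; rw [le_abs, le_abs] at this; push_cast at this; omega
    · omega
  · have h1 := A₂.mem_carrier_of_mem_edgeCarrier h1 hzε; have h3 := B₁.mem_carrier_of_mem_edgeCarrier h3 hzε
    have a := b1B z h3; have b := b2A z h1
    rw [abs_le, abs_le] at a; rw [le_abs, le_abs] at b; omega
  · have h1 := A₂.mem_carrier_of_mem_edgeCarrier h1 hzε; have h3 := h3 z hzε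
    rcases s2p z h1 with h | h
    · have := (annR (k := 8 * M) (by omega) z h).2.2; rw [le_abs, le_abs] at this; push_cast at this; omega
    · omega
  · exact Set.disjoint_left.1 hd₂ h1 h3

end QOpenArmsE

/-! ### The glued event with `zdFiveArmSepE` and its probability -/

section QProbabilityE

open scoped Classical

variable {m₁ M n : ℕ}

/-- The separated event (edge-disjoint form) is determined by the pairs of its zone sites. [folklore] -/
theorem determinedBy_zdFiveArmSepE {k N R : ℕ} (hk : 128 ≤ k) (hN : 2 * k ≤ N) (hR : N + N / 8 + 1 ≤ R) :
    DeterminedBy (zdFiveArmSepE k N)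
      ↑(((box 2 R).filter fun v => v ∈ zdSepZoneR k N ∪ zdSepZoneL k N ∪ (zdSepZoneT k N ∪ zdSepZoneB k N)).sym2) := by
  have hsub : ∀ Z : Set (Site 2), Z ⊆ zdSepZoneR k N ∪ zdSepZoneL k N ∪ (zdSepZoneT k N ∪ zdSepZoneB k N) →
      Z.sym2 ⊆ ↑(((box 2 R).filter fun v => v ∈ zdSepZoneR k N ∪ zdSepZoneL k N ∪ (zdSepZoneT k N ∪ zdSepZoneB k N)).sym2) := by
    intro Z hZ e he
    rw [Finset.mem_coe, Finset.mem_sym2_iff]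
    intro x hx
    have hxZ := hZ (Set.mem_sym2_iff_subset.1 he hx)
    rw [Finset.mem_filter, mem_box, Fin.forall_fin_two]
    obtain ⟨⟨h0, h1⟩, -⟩ := zone_sites hk hN hxZ
    have e0 := abs_le.1 h0; have e1 := abs_le.1 h1
    exact ⟨⟨⟨by omega, by omega⟩, ⟨by omega, by omega⟩⟩, hxZ⟩
  exact ((determinedBy_zdSepOpenPairRE (hsub _ fun x hx => Or.inl (Or.inl hx))).inter
    (determinedBy_zdSepOpenArmL (hsub _ fun x hx => Or.inl (Or.inr hx)))).inter
    ((determinedBy_zdSepDualArmT (hsub _ fun x hx => Or.inr (Or.inl hx))).inter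
      (determinedBy_zdSepDualArmB (hsub _ fun x hx => Or.inr (Or.inr hx))))

/-- The separated event (edge-disjoint form) is measurable (for `128 ≤ k`, `2k ≤ N`). [folklore] -/
theorem measurableSet_zdFiveArmSepE {k N : ℕ} (hk : 128 ≤ k) (hN : 2 * k ≤ N) : MeasurableSet (zdFiveArmSepE k N) :=
  (determinedBy_zdFiveArmSepE hk hN le_rfl).measurableSet_of_finset

/-- **Independence of the two separated events of `(Q)`** (edge-disjoint form). [folklore] -/
theorem real_zdFiveArmSepE_inter (hm₁ : 128 ≤ m₁) (hM : 2 * m₁ ≤ M) (hn : 16 * M ≤ n) :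
    (bondPercolation (zdGraph 2) half).real (zdFiveArmSepE m₁ M ∩ zdFiveArmSepE (8 * M) n) =
      (bondPercolation (zdGraph 2) half).real (zdFiveArmSepE m₁ M) *
        (bondPercolation (zdGraph 2) half).real (zdFiveArmSepE (8 * M) n) :=
  bondPercolation_real_inter_of_disjoint (zdGraph 2) half (disjoint_qPairsInner_qPairsOuter hm₁ hM hn)
    (determinedBy_zdFiveArmSepE hm₁ hM le_rfl) (determinedBy_zdFiveArmSepE (by omega) (by omega) le_rfl)
    (measurableSet_zdFiveArmSepE hm₁ hM) (measurableSet_zdFiveArmSepE (by omega) (by omega))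


variable (m₁ M n)

/-- **The glued event of `(Q)`, edge-disjoint form**: the two separated events and the nine
corridors. [cite: Nolin2008, §4.3, Prop. 12 (ii)] -/
def qGluedE : Set (BondConfig (Site 2)) :=
  zdFiveArmSepE m₁ M ∩ zdFiveArmSepE (8 * M) n ∩ (qCorrOpen M ∩ qCorrDual M)

variable {m₁ M n}

/-- **The probability of the glued event of `(Q)`, edge-disjoint form**: by generalised FKG, RSW in
the nine corridors and the independence of the two separated events,
`c⁹ · P(zdFiveArmSepE m₁ M) · P(zdFiveArmSepE (8M) n) ≤ P(qGluedE m₁ M n)`. [cite: Nolin2008, §4.3, Prop. 12 (ii) and Lemma 13] -/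
theorem real_qGluedE_ge (hm₁ : 128 ≤ m₁) (hM : 2 * m₁ ≤ M) (hn : 16 * M ≤ n)
    {c : ℝ} (hc0 : 0 < c) (hc : ∀ l : ℕ, 1 ≤ l → c ≤ crossingProb half (1024 * l - 1) (l - 1)) :
    c ^ 9 * ((bondPercolation (zdGraph 2) half).real (zdFiveArmSepE m₁ M) *
        (bondPercolation (zdGraph 2) half).real (zdFiveArmSepE (8 * M) n)) ≤
      (bondPercolation (zdGraph 2) half).real (qGluedE m₁ M n) := by
  set μ := bondPercolation (zdGraph 2) half with hμ
  have hM64 : 64 ≤ M := by omega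
  have hSP : Disjoint (qPairsS m₁ M n) (qPairsP M) := disjoint_sdiff_self_left.mono_right le_sup_left
  have hSM : Disjoint (qPairsS m₁ M n) (qPairsM M) := disjoint_sdiff_self_left.mono_right le_sup_right
  have hPM := disjoint_qPairsP_qPairsM hM64
  have hRL := qZoneRL_sym2_subset hm₁ hM hn
  have hTB := qZoneTB_sym2_subset hm₁ hM hn
  set Ap := (zdSepOpenPairRE m₁ M ∩ zdSepOpenArmL m₁ M) ∩ (zdSepOpenPairRE (8 * M) n ∩ zdSepOpenArmL (8 * M) n) with hAp
  set Am := (zdSepDualArmT m₁ M ∩ zdSepDualArmB m₁ M) ∩ (zdSepDualArmT (8 * M) n ∩ zdSepDualArmB (8 * M) n) with hAm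
  have dAp : DeterminedBy Ap (↑(qPairsS m₁ M n) ∪ ↑(qPairsP M)) :=
    ((determinedBy_zdSepOpenPairRE ((Set.subset_union_left.trans Set.subset_union_left).trans hRL)).inter
      (determinedBy_zdSepOpenArmL ((Set.subset_union_right.trans Set.subset_union_left).trans hRL))).inter
    ((determinedBy_zdSepOpenPairRE ((Set.subset_union_left.trans Set.subset_union_right).trans hRL)).inter
      (determinedBy_zdSepOpenArmL ((Set.subset_union_right.trans Set.subset_union_right).trans hRL)))
  have dAm : DeterminedBy Am (↑(qPairsS m₁ M n) ∪ ↑(qPairsM M)) :=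
    ((determinedBy_zdSepDualArmT ((Set.subset_union_left.trans Set.subset_union_left).trans hTB)).inter
      (determinedBy_zdSepDualArmB ((Set.subset_union_right.trans Set.subset_union_left).trans hTB))).inter
    ((determinedBy_zdSepDualArmT ((Set.subset_union_left.trans Set.subset_union_right).trans hTB)).inter
      (determinedBy_zdSepDualArmB ((Set.subset_union_right.trans Set.subset_union_right).trans hTB)))
  have hFKG := bondPercolation_locallyMonotone_fkg (zdGraph 2) half hSP hSM hPM
    (((isUpperSet_zdSepOpenPairRE_inter_zdSepOpenArmL _ _).inter (isUpperSet_zdSepOpenPairRE_inter_zdSepOpenArmL _ _)))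
    (((isLowerSet_zdSepDualArmT_inter_zdSepDualArmB _ _).inter (isLowerSet_zdSepDualArmT_inter_zdSepDualArmB _ _)))
    (isUpperSet_qCorrOpen (M := M)) (isLowerSet_qCorrDual (M := M)) dAp dAm determinedBy_qCorrOpen determinedBy_qCorrDual
  -- corridor bounds
  have hc0' := hc0.le
  have hBp : c ^ 7 ≤ μ.real (qCorrOpen M) := by
    have e7 : c ^ 7 = c * c * c * (c * c * c * c) := by ring
    rw [e7]
    unfold qCorrOpen
    refine le_real_inter_of_upper (by positivity) (by positivity)
      (((isUpperSet_lrCrossingAt _ _ _).inter (isUpperSet_tbCrossingAt' _ _ _)).inter (isUpperSet_lrCrossingAt _ _ _))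
      ((((isUpperSet_lrCrossingAt _ _ _).inter (isUpperSet_tbCrossingAt' _ _ _)).inter (isUpperSet_lrCrossingAt _ _ _)).inter
        (isUpperSet_lrCrossingAt _ _ _))
      (((measurableSet_lrCrossingAt _ _ _).inter (measurableSet_tbCrossingAt' _ _ _)).inter (measurableSet_lrCrossingAt _ _ _))
      ((((measurableSet_lrCrossingAt _ _ _).inter (measurableSet_tbCrossingAt' _ _ _)).inter (measurableSet_lrCrossingAt _ _ _)).inter
        (measurableSet_lrCrossingAt _ _ _)) ?_ ?_
    · exact le_real_inter_of_upper (by positivity) hc0'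
        ((isUpperSet_lrCrossingAt _ _ _).inter (isUpperSet_tbCrossingAt' _ _ _)) (isUpperSet_lrCrossingAt _ _ _)
        ((measurableSet_lrCrossingAt _ _ _).inter (measurableSet_tbCrossingAt' _ _ _)) (measurableSet_lrCrossingAt _ _ _)
        (le_real_inter_of_upper hc0' hc0' (isUpperSet_lrCrossingAt _ _ _) (isUpperSet_tbCrossingAt' _ _ _)
          (measurableSet_lrCrossingAt _ _ _) (measurableSet_tbCrossingAt' _ _ _)
          (le_real_lrCrossingAt_of_rsw hc _ (by omega)) (le_real_tbCrossingAt'_of_rsw hc _ (by omega)))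
        (le_real_lrCrossingAt_of_rsw hc _ (by omega))
    · refine le_real_inter_of_upper (by positivity) hc0'
        (((isUpperSet_lrCrossingAt _ _ _).inter (isUpperSet_tbCrossingAt' _ _ _)).inter (isUpperSet_lrCrossingAt _ _ _))
        (isUpperSet_lrCrossingAt _ _ _)
        (((measurableSet_lrCrossingAt _ _ _).inter (measurableSet_tbCrossingAt' _ _ _)).inter (measurableSet_lrCrossingAt _ _ _))
        (measurableSet_lrCrossingAt _ _ _) ?_ (le_real_lrCrossingAt_of_rsw hc _ (by omega))
      exact le_real_inter_of_upper (by positivity) hc0'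
        ((isUpperSet_lrCrossingAt _ _ _).inter (isUpperSet_tbCrossingAt' _ _ _)) (isUpperSet_lrCrossingAt _ _ _)
        ((measurableSet_lrCrossingAt _ _ _).inter (measurableSet_tbCrossingAt' _ _ _)) (measurableSet_lrCrossingAt _ _ _)
        (le_real_inter_of_upper hc0' hc0' (isUpperSet_lrCrossingAt _ _ _) (isUpperSet_tbCrossingAt' _ _ _)
          (measurableSet_lrCrossingAt _ _ _) (measurableSet_tbCrossingAt' _ _ _)
          (le_real_lrCrossingAt_of_rsw hc _ (by omega)) (le_real_tbCrossingAt'_of_rsw hc _ (by omega)))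
        (le_real_lrCrossingAt_of_rsw hc _ (by omega))
  have hBm : c ^ 2 ≤ μ.real (qCorrDual M) := by
    rw [pow_two]
    exact le_real_inter_of_lower hc0' hc0' (isLowerSet_dualFaceCrossing _ _ _) (isLowerSet_dualFaceCrossing _ _ _)
      (measurableSet_dualFaceCrossing _ _ _) (measurableSet_dualFaceCrossing _ _ _)
      (le_real_dualFaceCrossing_of_rsw hc _ (by omega)) (le_real_dualFaceCrossing_of_rsw hc _ (by omega))
  -- assembly
  have hsep : zdFiveArmSepE m₁ M ∩ zdFiveArmSepE (8 * M) n = Ap ∩ Am := by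
    rw [hAp, hAm, zdFiveArmSepE, zdFiveArmSepE,
      Set.inter_inter_inter_comm (zdSepOpenPairRE m₁ M ∩ zdSepOpenArmL m₁ M) (zdSepDualArmT m₁ M ∩ zdSepDualArmB m₁ M)]
  have hset : qGluedE m₁ M n = Ap ∩ Am ∩ (qCorrOpen M ∩ qCorrDual M) := by
    rw [qGluedE, hsep]
  rw [hset, ← real_zdFiveArmSepE_inter hm₁ hM hn, hsep]
  calc c ^ 9 * μ.real (Ap ∩ Am) = μ.real (Ap ∩ Am) * (c ^ 7 * c ^ 2) := by ring
    _ ≤ μ.real (Ap ∩ Am) * (μ.real (qCorrOpen M) * μ.real (qCorrDual M)) :=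
        mul_le_mul_of_nonneg_left (mul_le_mul hBp hBm (by positivity) measureReal_nonneg) measureReal_nonneg
    _ ≤ _ := hFKG


end QProbabilityE

/-! ### `qGluedE ⊆ zdFiveArmClusters` and the gluing inequality -/

section QInclusionE

variable {m₁ M n : ℕ}

set_option maxHeartbeats 800000 in
/-- **`qGluedE m₁ M n ⊆ zdFiveArmClusters m₁ n`** (for lattice configurations): the glued upper
right arm and the glued left arm are in distinct annulus-clusters (the two glued dual barriers and
`not_openConnIn_sqAnnulus_of_dualArmsTB`), and the glued lower right arm is edge-disjoint from the
upper one (`qArms_edgeDisjoint`) and from the left one (distinct clusters again). [cite: Nolin2008, §4.3, Prop. 12 (ii)] -/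
theorem mem_zdFiveArmClusters_of_mem_qGluedE (hm₁ : 128 ≤ m₁) (hM : 2 * m₁ ≤ M) (hn : 16 * M ≤ n)
    {ω : BondConfig (Site 2)} (hωE : ω ⊆ (zdGraph 2).edgeSet) (hω : ω ∈ qGluedE m₁ M n) :
    ω ∈ zdFiveArmClusters m₁ n := by
  obtain ⟨⟨⟨⟨⟨Ap₁, Am₁, hd₁⟩, ⟨AL₁⟩⟩, ⟨AT₁⟩, ⟨AB₁⟩⟩, ⟨⟨Ap₂, Am₂, hd₂⟩, ⟨AL₂⟩⟩, ⟨AT₂⟩, ⟨AB₂⟩⟩,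
    ⟨⟨⟨hR1, hR2⟩, hR3⟩, ⟨⟨hS1, hS2⟩, hS3⟩, hL⟩, hT, hB⟩ := hω
  have hm1 : 1 ≤ m₁ := by omega
  obtain ⟨W₁, hW₁e, hW₁s, hW₁c, hW₁E⟩ := qArm_RposE hm₁ hM hn hωE Ap₁ Ap₂ hR1 hR2 hR3
  obtain ⟨W₃, hW₃e, hW₃s, hW₃c, hW₃E⟩ := qArm_RnegE hm₁ hM hn hωE Am₁ Am₂ hS1 hS2 hS3
  obtain ⟨W₂, hW₂e, hW₂s⟩ := qArm_L hm₁ hM hn hωE AL₁ AL₂ hL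
  obtain ⟨δ₁, hδ₁⟩ := qBarrier_T hm₁ hM AT₁ AT₂ hT
  obtain ⟨δ₂, hδ₂⟩ := qBarrier_B hm₁ hM AB₁ AB₂ hB
  have hx₁ := Ap₁.hx; have hx₃ := Am₁.hx; have hx₂ := AL₁.hx
  have hz₁ := Ap₂.hz; have hz₃ := Am₂.hz; have hz₂ := AL₂.hz
  have hf₁ := AT₁.hf; have hg₁ := AT₂.hg; have hf₂ := AB₁.hf; have hg₂ := AB₂.hg
  have barrier : ∀ {e : Site 2}, e 0 = m₁ → |e 1| ≤ (m₁ : ℤ) - 1 → ω ∉ openConnIn (sqAnnulus m₁ n) e AL₁.x := by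
    intro e he0 he1
    exact not_openConnIn_sqAnnulus_of_dualArmsTB (by omega) (by omega) hωE he0 he1 hx₂.1
      (by rw [abs_of_nonneg hx₂.2.1]; omega) δ₁ ⟨by omega, by omega, by omega⟩ (by omega) hδ₁
      δ₂ ⟨by omega, by omega, by omega⟩ (by omega) hδ₂
  refine ⟨Ap₁.x, AL₁.x, Am₁.x, Ap₂.z, AL₂.z, Am₂.z, W₁, W₂, W₃,
    mem_siteSphere_of_apply_zero hm1 (Or.inl hx₁.1) (abs_le.2 ⟨by omega, by omega⟩),
    mem_siteSphere_of_apply_zero hm1 (Or.inr hx₂.1) (abs_le.2 ⟨by omega, by omega⟩),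
    mem_siteSphere_of_apply_zero hm1 (Or.inl hx₃.1) (abs_le.2 ⟨by omega, by omega⟩),
    mem_siteSphere_of_apply_zero (by omega) (Or.inl hz₁.1) (abs_le.2 ⟨by omega, by omega⟩),
    mem_siteSphere_of_apply_zero (by omega) (Or.inr hz₂.1) (abs_le.2 ⟨by omega, by omega⟩),
    mem_siteSphere_of_apply_zero (by omega) (Or.inl hz₃.1) (abs_le.2 ⟨by omega, by omega⟩),
    hW₁s, hW₂s, hW₃s, hW₁e, hW₂e, hW₃e, fun e he₁ he₃ => ?_, fun e he₂ he₃ => ?_,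
    barrier hx₁.1 (by rw [abs_of_nonneg (by omega)]; omega)⟩
  · -- the two right arms share no edge
    obtain ⟨v, hv⟩ : ∃ v, v ∈ e := ⟨e.out.1, Sym2.out_fst_mem e⟩
    exact qArms_edgeDisjoint hm₁ hM hn Ap₁ Am₁ hd₁ Ap₂ Am₂ hd₂ hv (hW₁E e he₁) (hW₃E e he₃)
  · -- the left arm and the lower right arm share no edge: they lie in distinct annulus-clusters
    obtain ⟨v, hv⟩ : ∃ v, v ∈ e := ⟨e.out.1, Sym2.out_fst_mem e⟩
    have hv₂ := mem_support_of_mem_edges_of_mem W₂ he₂ hv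
    have hv₃ := mem_support_of_mem_edges_of_mem W₃ he₃ hv
    apply barrier hx₃.1 (by rw [abs_of_nonpos (by omega)]; omega)
    refine mem_openConnIn_of_walk ((W₃.takeUntil v hv₃).append (W₂.takeUntil v hv₂).reverse) (fun z hz => ?_) (fun e' he' => ?_)
    · rw [Walk.mem_support_append_iff, Walk.support_reverse, List.mem_reverse] at hz
      rcases hz with hz | hz
      · exact hW₃s z (W₃.support_takeUntil_subset_support hv₃ hz)
      · exact hW₂s z (W₂.support_takeUntil_subset_support hv₂ hz)
    · rw [Walk.edges_append, List.mem_append, Walk.edges_reverse, List.mem_reverse] at he'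
      rcases he' with he' | he'
      · exact hW₃e e' (W₃.edges_takeUntil_subset_edges hv₃ he')
      · exact hW₂e e' (W₂.edges_takeUntil_subset_edges hv₂ he')

/-- **The gluing inequality of `(Q)`, edge-disjoint form**: for `128 ≤ m₁`, `2 m₁ ≤ M`, `16 M ≤ n`
and the RSW constant `c` of aspect ratio `1024`,
`c⁹ · P(zdFiveArmSepE m₁ M) · P(zdFiveArmSepE (8M) n) ≤ P(zdFiveArmClusters m₁ n)`. [cite: Nolin2008, §4.3, Prop. 12 (ii); KestenScalingCMP1987, Lemma 6] -/
theorem real_zdFiveArmSepE_mul_le_real_zdFiveArmClusters (hm₁ : 128 ≤ m₁) (hM : 2 * m₁ ≤ M) (hn : 16 * M ≤ n)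
    {c : ℝ} (hc0 : 0 < c) (hc : ∀ l : ℕ, 1 ≤ l → c ≤ crossingProb half (1024 * l - 1) (l - 1)) :
    c ^ 9 * ((bondPercolation (zdGraph 2) half).real (zdFiveArmSepE m₁ M) *
        (bondPercolation (zdGraph 2) half).real (zdFiveArmSepE (8 * M) n)) ≤
      (bondPercolation (zdGraph 2) half).real (zdFiveArmClusters m₁ n) := by
  refine (real_qGluedE_ge hm₁ hM hn hc0 hc).trans ?_
  refine ENNReal.toReal_mono (measure_ne_top _ _) (measure_mono_ae ?_)
  filter_upwards [ae_subset_edgeSet (zdGraph 2) half] with ω hωE hω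
  exact mem_zdFiveArmClusters_of_mem_qGluedE hm₁ hM hn hωE hω

end QInclusionE

/-! ### Quasi-multiplicativity from `hsepE` -/

section QuasiMultE

set_option maxHeartbeats 800000 in
/-- **Quasi-multiplicativity of the five-arm probability from Kesten's separation theorem, edge-disjoint
form** (Nolin 2008, Prop. 12 (ii) and Prop. 16; DMT 2021, Prop. 6.3, `q = 1`): if
`cs · P(zdFiveArmClusters n N) ≤ P(zdFiveArmSepE n N)` for `m₁ ≤ n`, `2n ≤ N` (`m₁ ≥ 128`), and
`cL (r/R)² ≤ P(zdFiveArmClusters r R)` for `1 ≤ r`, `A r ≤ R`, then for some `c > 0` and all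
`m₁ ≤ m ≤ n`, `c · P(T̃(m₁, m)) · P(T̃(m, n)) ≤ P(T̃(m₁, n))` (`T̃ = zdFiveArmClusters`).  The main
case `2m₁ ≤ m`, `16 m ≤ n` is the gluing inequality with `M = m` and `T̃(m, n) ⊆ T̃(8m, n)`; the
bounded-ratio cases use `h5`. [cite: Nolin2008, §4.4, Prop. 16 and §4.3, Prop. 12 (ii)] [cite: DuminilCopinManolescuTassion2021, §6.2, Prop. 6.3] -/
theorem zdFiveArm_quasiMult_of_separationE {m₁ : ℕ} (hm₁ : 128 ≤ m₁) {cs : ℝ} (hcs : 0 < cs)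
    (hsep : ∀ n N : ℕ, m₁ ≤ n → 2 * n ≤ N →
      cs * (bondPercolation (zdGraph 2) half).real (zdFiveArmClusters n N) ≤
        (bondPercolation (zdGraph 2) half).real (zdFiveArmSepE n N))
    {A : ℕ} {cL : ℝ} (hcL : 0 < cL)
    (h5 : ∀ r R : ℕ, 1 ≤ r → A * r ≤ R →
      cL * ((r : ℝ) / R) ^ 2 ≤ (bondPercolation (zdGraph 2) half).real (zdFiveArmClusters r R)) :
    ∃ c : ℝ, 0 < c ∧ ∀ m n : ℕ, m₁ ≤ m → m ≤ n →
      c * (bondPercolation (zdGraph 2) half).real (zdFiveArmClusters m₁ m) *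
          (bondPercolation (zdGraph 2) half).real (zdFiveArmClusters m n) ≤
        (bondPercolation (zdGraph 2) half).real (zdFiveArmClusters m₁ n) := by
  obtain ⟨c, hc0, hc⟩ := rsw_lowerBound_holds 1024 (by norm_num)
  set μ := bondPercolation (zdGraph 2) half with hμ
  set K := fun m n : ℕ => μ.real (zdFiveArmClusters m n) with hK
  set c₀ := c ^ 9 * cs ^ 2 with hc₀
  have hc₀0 : 0 < c₀ := by positivity
  set q := cL / ((max 512 A : ℕ) : ℝ) ^ 2 with hq
  have hq0 : 0 < q := by
    have : (0 : ℝ) < ((max 512 A : ℕ) : ℝ) := by exact_mod_cast (show 0 < max 512 A by omega)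
    positivity
  have hm1 : 1 ≤ m₁ := by omega
  -- the gluing inequality combined with separation
  have main : ∀ M n : ℕ, 2 * m₁ ≤ M → 16 * M ≤ n → c₀ * K m₁ M * K (8 * M) n ≤ K m₁ n := by
    intro M n hM hn
    have h := real_zdFiveArmSepE_mul_le_real_zdFiveArmClusters hm₁ hM hn hc0 hc
    have h1 := hsep m₁ M le_rfl hM
    have h2 := hsep (8 * M) n (by omega) (by omega)
    have hK1 : 0 ≤ K m₁ M := measureReal_nonneg
    have hK2 : 0 ≤ K (8 * M) n := measureReal_nonneg
    calc c₀ * K m₁ M * K (8 * M) n = c ^ 9 * ((cs * K m₁ M) * (cs * K (8 * M) n)) := by rw [hc₀]; ring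
      _ ≤ c ^ 9 * (μ.real (zdFiveArmSepE m₁ M) * μ.real (zdFiveArmSepE (8 * M) n)) :=
          mul_le_mul_of_nonneg_left (mul_le_mul h1 h2 (by positivity) measureReal_nonneg) (by positivity)
      _ ≤ K m₁ n := h
  -- bounded-ratio lower bound
  have low : ∀ r R : ℕ, 1 ≤ r → r ≤ R → R ≤ 512 * r → q ≤ K r R :=
    fun r R hr hrR hR => real_zdFiveArmClusters_ge_of_ratio hcL h5 hr hrR hR
  have q_le_one : q ≤ 1 := (low 1 1 le_rfl le_rfl (by norm_num)).trans measureReal_le_one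
  have Kle : ∀ m n, K m n ≤ 1 := fun m n => measureReal_le_one
  have K0 : ∀ m n, 0 ≤ K m n := fun m n => measureReal_nonneg
  refine ⟨min c₀ 1 * q, by positivity, fun m n hm hmn => ?_⟩
  have hmin0 : 0 ≤ min c₀ 1 := le_min hc₀0.le zero_le_one
  have hcc : min c₀ 1 * q ≤ c₀ * q := mul_le_mul_of_nonneg_right (min_le_left _ _) hq0.le
  have hcq : min c₀ 1 * q ≤ q := by
    calc min c₀ 1 * q ≤ 1 * q := mul_le_mul_of_nonneg_right (min_le_right _ _) hq0.le
      _ = q := one_mul q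
  have hcc₀ : min c₀ 1 * q ≤ c₀ := by
    calc min c₀ 1 * q ≤ c₀ * q := hcc
      _ ≤ c₀ * 1 := mul_le_mul_of_nonneg_left q_le_one hc₀0.le
      _ = c₀ := mul_one c₀
  have hc0' : 0 ≤ min c₀ 1 * q := mul_nonneg hmin0 hq0.le
  by_cases hA : 2 * m₁ ≤ m
  · by_cases hB : 16 * m ≤ n
    · -- main case, `M = m`
      have h := main m n hA hB
      have hmono : K m n ≤ K (8 * m) n := real_zdFiveArmClusters_mono half (by omega) (by omega) le_rfl
      calc min c₀ 1 * q * K m₁ m * K m n ≤ c₀ * K m₁ m * K (8 * m) n :=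
            mul_le_mul (mul_le_mul_of_nonneg_right hcc₀ (K0 _ _)) hmono (K0 _ _) (mul_nonneg hc₀0.le (K0 _ _))
        _ ≤ K m₁ n := h
    · have hB' := not_le.1 hB
      by_cases hC : 32 * m₁ ≤ m
      · -- `M = m / 16`
        have h := main (m / 16) n (by omega) (by omega)
        have hmono : K m₁ m ≤ K m₁ (m / 16) := real_zdFiveArmClusters_mono half le_rfl (by omega) (by omega)
        have hlow := low (8 * (m / 16)) n (by omega) (by omega) (by omega)
        calc min c₀ 1 * q * K m₁ m * K m n ≤ c₀ * q * K m₁ m * 1 :=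
              mul_le_mul (mul_le_mul_of_nonneg_right hcc (K0 _ _)) (Kle _ _) (K0 _ _)
                (mul_nonneg (mul_nonneg hc₀0.le hq0.le) (K0 _ _))
          _ = c₀ * K m₁ m * q := by ring
          _ ≤ c₀ * K m₁ (m / 16) * K (8 * (m / 16)) n :=
              mul_le_mul (mul_le_mul_of_nonneg_left hmono hc₀0.le) hlow hq0.le (mul_nonneg hc₀0.le (K0 _ _))
          _ ≤ K m₁ n := h
      · have hC' := not_le.1 hC
        have hlow := low m₁ n hm1 (by omega) (by omega)
        calc min c₀ 1 * q * K m₁ m * K m n ≤ q * 1 * 1 :=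
              mul_le_mul (mul_le_mul hcq (Kle _ _) (K0 _ _) hq0.le) (Kle _ _) (K0 _ _) (by positivity)
          _ = q := by ring
          _ ≤ K m₁ n := hlow
  · have hA' := not_le.1 hA
    by_cases hB : 32 * m₁ ≤ n
    · -- `M = 2 m₁`
      have h := main (2 * m₁) n le_rfl (by omega)
      have hmono : K m n ≤ K (8 * (2 * m₁)) n := real_zdFiveArmClusters_mono half (by omega) (by omega) le_rfl
      have hlow := low m₁ (2 * m₁) hm1 (by omega) (by omega)
      calc min c₀ 1 * q * K m₁ m * K m n ≤ c₀ * q * 1 * K (8 * (2 * m₁)) n :=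
            mul_le_mul (mul_le_mul hcc (Kle _ _) (K0 _ _) (by positivity)) hmono (K0 _ _) (by positivity)
        _ = c₀ * q * K (8 * (2 * m₁)) n := by ring
        _ ≤ c₀ * K m₁ (2 * m₁) * K (8 * (2 * m₁)) n :=
            mul_le_mul_of_nonneg_right (mul_le_mul_of_nonneg_left hlow hc₀0.le) (K0 _ _)
        _ ≤ K m₁ n := h
    · have hB' := not_le.1 hB
      have hlow := low m₁ n hm1 (by omega) (by omega)
      calc min c₀ 1 * q * K m₁ m * K m n ≤ q * 1 * 1 :=
            mul_le_mul (mul_le_mul hcq (Kle _ _) (K0 _ _) hq0.le) (Kle _ _) (K0 _ _) (by positivity)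
        _ = q := by ring
        _ ≤ K m₁ n := hlow

end QuasiMultE

end Literature.Probability.Percolation

end
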